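import Literature.NumberTheory.Automorphic.UnitaryGroupDoubledSiegelGeneration
import Literature.NumberTheory.GelbartRogawski1991.DoubledUnitaryGlobalSplittingDataGen
import Literature.NumberTheory.GelbartRogawski1991.DoubledWeilRepresentationRationalSchur
import Literature.NumberTheory.GelbartRogawski1991.LocalDoubledUnitaryResidueWitness
import HarnessLib

/-!
# Rational clause of the doubled Weil representation, I: generation, adelic Schur, pinning, principal ideles — general `E/F`

General-quadratic-extension twin (namespace `GRConstructionGen`) of `DoubledWeilRepresentationRationalSchur` (CM case,
namespace `GRConstruction`): the CM field `L ⊃ L⁺` with complex conjugation and `realDiagonal` Gram data is replaced by an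
arbitrary quadratic extension `E/F` of number fields with `c ∈ Aut(E/F)`, `c δ = -δ ≠ 0`, `δ² = d ∈ F`, and symmetric
invertible Gram matrices `TV`, `TW` over `F` (objects of `DoubledUnitaryGlobalSplittingDataGen`).  Statements and proofs are
verbatim transports (the field-independent packaging lemmas `central_of_scalar_abstract`, `pinned_abstract` are reused from
the CM file; `c ∘ c = id` is `UnitaryDualPair.LocalSplitting.galConj_apply_apply`).

[GelbartRogawski1991, §3.1 Prop. 3.1.1 p. 455 L1–2, "`s(G(F)) ⊆ i(Sp_F(W))`"] by doubling, first half of the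
RATIONAL CLAUSE for the objects of `DoubledUnitaryGlobalSplittingData`:
* **S2** `S2_ratH_normalClosure_siegel`: `H(L⁺)` is contained in the closure of the `H(L⁺)`-conjugates of
  `P_Δ(L⁺)` (the tree's `DoubledUnitary.toAdelic_mem_closure_siegelConjugates`, `UnitaryGroupDoubledSiegelGeneration`);
* **S3a** adelic Schur `S3a_central_of_proj_eq_one`: an element of `Mp(𝕎^𝔻)ᶜᵒⁿᵗ` over `1 ∈ Sp` is central (its
  operator is a scalar: tensor stripping `exists_omega_eq_adelicTensorEnd_id_left` + finite Schur);
* the PINNING LEMMA `eq_of_proj_eq_of_evalZero_eq`: two elements over the same symplectic element with the same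
  non-vanishing value-at-0 functional are equal;
* **S3b** `toSpD_mem_range_ratSp`: `ι^𝔻(H(L⁺)) ⊆ Sp_{2(n+n)}(L⁺)`;
* **S3c** `chiDet_mul_modDelta_eq_one_of_rational`: on RATIONAL `P_Δ`-elements the prescribed scalar
  `χ(det_Δ p)|det_Δ p|^{1/2}` is `1` (`det_Δ p` is a principal idele; `χ|_{L^×} = 1`, product formula);
* **S3b-val** `rFD_mem_evalZeroFixing_of_mem_closure`: `r_F^𝔻` of words in rational Levi ∕ lower-unipotent
  generators fixes values at the origin (`coe_ratThetaLiftCont_levi ∕ _low`).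
-/

set_option autoImplicit false

noncomputable section

open scoped Classical
open scoped Matrix Kronecker TensorProduct
open NumberField IsDedekindDomain
open Literature.RepresentationTheory.HeisenbergGroup
open Literature.NumberTheory.Automorphic
open Literature.NumberTheory.Weil1964
open Literature.NumberTheory.GaloisRepresentations

namespace Literature.NumberTheory.GelbartRogawski1991.GRConstructionGen

open UnitaryDualPair

variable (F : Type) [Field F] [NumberField F] (E : Type) [Field E] [NumberField E] [Algebra F E]
  [Algebra.IsQuadraticExtension F E]
variable (c : E ≃ₐ[F] E) {δ : E} (hcδ : c δ = -δ) (hδ : δ ≠ 0) {d : F} (hd : δ * δ = algebraMap F E d)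
variable {N M n : ℕ} (e : Fin N × Fin M ≃ Fin n)
  (TV : Matrix (Fin N) (Fin N) F) (hV : TV.IsSymm) (hVd : IsUnit TV.det)
  (TW : Matrix (Fin M) (Fin M) F) (hW : TW.IsSymm) (hWd : IsUnit TW.det)

include hV hW hVd hWd hcδ hδ in
/-- **S2 (the normal closure of `P_Δ(F)` is `H(F)`)**, on the tree's generic lemma
`DoubledUnitary.toAdelic_mem_closure_siegelConjugates` (`Literature/NumberTheory/Automorphic/UnitaryGroupDoubledSiegelGeneration.lean`).
[cite: GelbartRogawski1991, §3.1 Prop. 3.1.1 p. 455 L1–2] -/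
theorem S2_ratH_normalClosure_siegel :
    ∀ γ ∈ ratH F E c e TV TW, γ ∈ Subgroup.closure
      {x : HA F E c e TV TW | ∃ p ∈ ratH F E c e TV TW, ∃ h ∈ ratH F E c e TV TW,
        IsSiegelDelta F E c e TV TW p ∧ x = h * p * h⁻¹} := by
  rintro γ ⟨γ₀, rfl⟩
  set S : Matrix (Fin n) (Fin n) E := (gramR F e TV TW).map (algebraMap F E) with hS
  have hJ : hermD F E e TV TW = Matrix.reindex finSumFinEquiv finSumFinEquiv (Matrix.fromBlocks S 0 0 (-S)) := by
    rw [hermD, gramD, hS]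
    ext i j
    simp only [Matrix.map_apply, Matrix.reindex_apply, Matrix.submatrix_apply]
    rcases finSumFinEquiv.symm i with a | a <;> rcases finSumFinEquiv.symm j with b | b <;>
      simp [Matrix.fromBlocks, map_neg, map_zero]
  have hT : (gramR F e TV TW).IsSymm := by
    show (Matrix.reindex e e _).IsSymm
    exact (UnitaryGroup.isSymm_kronecker hV hW).submatrix _
  have hSσ : S.map (c : E →+* E) = S := by
    ext i j
    simp only [hS, Matrix.map_apply]
    exact c.commutes _
  have hSs : Sᵀ = S := by rw [hS, ← Matrix.transpose_map, hT.eq]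
  have hSu : IsUnit S.det := by
    rw [hS, ← RingHom.mapMatrix_apply, ← RingHom.map_det]
    exact (isUnit_det_gram F e hVd hWd).map _
  exact DoubledUnitary.toAdelic_mem_closure_siegelConjugates F E c
    (fun x => UnitaryDualPair.LocalSplitting.galConj_apply_apply F E c hcδ hδ x) hcδ hδ finSumFinEquiv
    hSσ hSs hSu _ hJ γ₀

include hVd hWd in
set_option maxHeartbeats 800000 in
/-- **ADELIC SCHUR (the analytic content of S3a and of the pinning lemma (r1))**: an element of `Mp(𝕎^𝔻)ᶜᵒⁿᵗ` over `1 ∈ Sp`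
acts on `𝒮(𝔸^{n+n})` by a SCALAR — tensor stripping `exists_omega_eq_adelicTensorEnd_id_left` reduces to the finite factor, where
Schur for the finite Schrödinger module is the tree's `eq_smul_id_of_comm`.
[cite: GelbartRogawski1991, §3.1 Prop. 3.1.1 p. 455 L1–2] -/
theorem exists_smul_of_proj_eq_one (q : MpD F e TV TW) (hq : projD F e TV TW q = 1) :
    ∃ c : ℂ, ∀ Φ : piSchwartzBruhat F (Fin (n + n)),
      ((q : adelicMp F (Fin (n + n)) (gramDA F e TV TW)) :
        symplecticGroup (polar (adelicForm F (Fin (n + n)) (gramDA F e TV TW))) ×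
          (piSchwartzBruhat F (Fin (n + n)) ≃ₗ[ℂ] piSchwartzBruhat F (Fin (n + n)))).2 Φ = c • Φ := by
  have hTu : IsUnit (gramDA F e TV TW) :=
    (Matrix.isUnit_iff_isUnit_det _).2 (isUnit_det_gramDA F e TV hVd TW hWd)
  have hTy : Function.Surjective fun y : Fin (n + n) → AdeleRing (𝓞 F) F => gramDA F e TV TW *ᵥ y :=
    (mulVec_bijective_of_isUnit hTu).2
  -- the symplectic component of `q` is `1`
  have hq0 : adelicMpCont.proj F (Fin (n + n)) (gramDA F e TV TW) q = 1 := hq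
  have hq1 : ((q : adelicMp F (Fin (n + n)) (gramDA F e TV TW)) :
      symplecticGroup (polar (adelicForm F (Fin (n + n)) (gramDA F e TV TW))) ×
        (piSchwartzBruhat F (Fin (n + n)) ≃ₗ[ℂ] piSchwartzBruhat F (Fin (n + n)))).1 = 1 := by
    rw [adelicMpCont.proj_apply, MpPsi.proj_apply] at hq0
    exact hq0
  -- (1) the operator of `q` is `1 ⊗ B`
  have harch : ∀ a w : Fin (n + n) → mixedEmbedding.mixedSpace F,
      (adelicMpCont.proj F (Fin (n + n)) (gramDA F e TV TW) q).1
        (archVec F (Fin (n + n)) a, archVec F (Fin (n + n)) w) =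
        (archVec F (Fin (n + n)) a, archVec F (Fin (n + n)) w) := by
    intro a w
    rw [hq0]
    rfl
  refine (exists_omega_eq_adelicTensorEnd_id_left hTu q harch).elim fun B hB => ?_
  have hB' : ∀ Φ : piSchwartzBruhat F (Fin (n + n)),
      ((q : adelicMp F (Fin (n + n)) (gramDA F e TV TW)) :
        symplecticGroup (polar (adelicForm F (Fin (n + n)) (gramDA F e TV TW))) ×
          (piSchwartzBruhat F (Fin (n + n)) ≃ₗ[ℂ] piSchwartzBruhat F (Fin (n + n)))).2 Φ =
        adelicTensorEnd LinearMap.id B Φ := by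
    intro Φ
    have h2 := LinearMap.congr_fun hB Φ
    rw [adelicMpCont.omega_apply, omegaPsi_apply] at h2
    exact h2
  -- (2) `1 ⊗ B` implements the identity on the finite Heisenberg elements, hence `B` commutes with `ρ_f`
  have himp := (mem_MpPsi _ _).1 (q : adelicMp F (Fin (n + n)) (gramDA F e TV TW)).2
  rw [hq1, map_one] at himp
  have hBimp : ∀ h ∈ finHeisenberg (gramDA F e TV TW), ∀ Φ : piSchwartzBruhat F (Fin (n + n)),
      adelicTensorEnd LinearMap.id B (adelicSchrodinger F (Fin (n + n)) (gramDA F e TV TW) h Φ) =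
        adelicSchrodinger F (Fin (n + n)) (gramDA F e TV TW)
          ((1 : Heisenberg.PseudoSymplectic (polar (adelicForm F (Fin (n + n)) (gramDA F e TV TW)))).act h)
          (adelicTensorEnd LinearMap.id B Φ) := by
    intro h _ Φ
    rw [← hB', ← hB']
    exact himp h Φ
  have hcomm : ∀ h ∈ finHeisenberg (gramDA F e TV TW),
      B ∘ₗ finSchrodinger (gramDA F e TV TW) h = finSchrodinger (gramDA F e TV TW) h ∘ₗ B := by
    intro h hh
    have := comp_finSchrodinger_of_finImplementer hBimp hh
    rwa [Heisenberg.PseudoSymplectic.act_one] at this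
  -- (3) Schur for the finite Schrödinger module
  have hCtr : ∀ (k : Fin (n + n) → FiniteAdeleRing (𝓞 F) F) (f : FinSB F (Fin (n + n))),
      B (finTranslateSB F (Fin (n + n)) k f) = finTranslateSB F (Fin (n + n)) k (B f) := by
    intro k f
    have hc := LinearMap.congr_fun
      (hcomm _ (ofVec_mem_finHeisenberg (finIdem_smul_piAdeleSplit_zero k) (smul_zero _))) f
    rw [finSchrodinger_ofVec_inl] at hc
    exact hc
  have hCmod : ∀ (y : Fin (n + n) → FiniteAdeleRing (𝓞 F) F) (f : FinSB F (Fin (n + n))),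
      B (finModulateSB F (Fin (n + n)) y f) = finModulateSB F (Fin (n + n)) y (B f) := by
    intro y f
    refine (exists_fin_mulVec_eq hTy y).elim fun y' hy' => ?_
    have hc := LinearMap.congr_fun (hcomm _ (ofVec_mem_finHeisenberg (smul_zero _) hy'.1)) f
    rw [finSchrodinger_ofVec_inr (gramDA F e TV TW) hy'.2] at hc
    exact hc
  refine (eq_smul_id_of_comm B hCtr hCmod).elim fun c hc => ?_
  refine ⟨c, fun Φ => ?_⟩
  rw [hB', hc, adelicTensorEnd_smul_right, adelicTensorEnd_id]
  rfl

include hVd hWd in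
/-- **S3a (ADELIC SCHUR ⇒ CENTRAL)**: an element of `Mp(𝕎^𝔻)ᶜᵒⁿᵗ` over `1 ∈ Sp` is CENTRAL.
[cite: GelbartRogawski1991, §3.1 Prop. 3.1.1 p. 455 L1–2] -/
theorem S3a_central_of_proj_eq_one (q : MpD F e TV TW) (hq : projD F e TV TW q = 1) :
    q ∈ Subgroup.center (MpD F e TV TW) :=
  (exists_smul_of_proj_eq_one F e TV hVd TW hWd q hq).elim fun c hc =>
    GRConstruction.central_of_scalar_abstract (projD F e TV TW)
      ((MpPsi.toOp _).comp (MpD F e TV TW).subtype)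
      (fun x y h1 h2 => eq_of_proj_eq_of_op_eq F e TV TW x y h1 h2) q hq c hc

include hVd hWd in
/-- **THE PINNING LEMMA — «an evaluation-form implementer is pinned by its value-at-0 scalar»**:
two elements of `Mp(𝕎^𝔻)ᶜᵒⁿᵗ` over the SAME symplectic element whose operators have the same value-at-the-origin functional
`Φ ↦ (ω(·)Φ)(0)` — not identically zero for the first — are EQUAL.  (This is exactly what makes the parabolic prescription of
`IsDoubledWeilRep` ∕ `ParabolicNormalisedAt` a NORMALISATION and the existence stubs rigid; used in S3 and S1asm.)
[cite: GelbartRogawski1991, §3.1 Prop. 3.1.1 p. 455 L1–2] -/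
theorem eq_of_proj_eq_of_evalZero_eq (x y : MpD F e TV TW)
    (hπ : projD F e TV TW x = projD F e TV TW y)
    (hev : ∀ Φ : piSchwartzBruhat F (Fin (n + n)), opD F e TV TW x Φ 0 = opD F e TV TW y Φ 0)
    (hne : ∃ Φ : piSchwartzBruhat F (Fin (n + n)), opD F e TV TW x Φ 0 ≠ 0) : x = y :=
  GRConstruction.pinned_abstract (projD F e TV TW) ((MpPsi.toOp _).comp (MpD F e TV TW).subtype)
    (fun x y h1 h2 => eq_of_proj_eq_of_op_eq F e TV TW x y h1 h2)
    (fun z hz => exists_smul_of_proj_eq_one F e TV hVd TW hWd z hz)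
    { toFun := fun Φ : piSchwartzBruhat F (Fin (n + n)) => (Φ : (Fin (n + n) → AdeleRing (𝓞 F) F) → ℂ) 0
      map_add' := fun _ _ => rfl
      map_smul' := fun _ _ => rfl }
    x y hπ hev hne

/-- **S3b (RATIONALITY OF `ι^𝔻` ON `H(L⁺)`)**: `ι^𝔻(H(L⁺)) ⊆ Sp_{L⁺}(𝕎^𝔻) = range ratSp` — the tree's
`UnitaryGroup.adelicToSymplectic_toAdelic_mem_range`. [cite: GelbartRogawski1991, §3.1 Prop. 3.1.1 p. 455 L1–2] -/
theorem toSpD_mem_range_ratSp (h : HA F E c e TV TW) (hh : h ∈ ratH F E c e TV TW) :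
    toSpD F E c hcδ hδ hd e TV hV TW hW h ∈ (ratSp F (gramDA F e TV TW) (isUnit_det_gramDA F e TV hVd TW hWd)).range := by
  obtain ⟨γ, hγ⟩ := MonoidHom.mem_range.1 hh
  rw [← hγ]
  unfold ratSp
  exact UnitaryGroup.adelicToSymplectic_toAdelic_mem_range F E c (n + n)
    hcδ hδ hd (gramD_isSymm F e TV hV TW hW)
    (isUnit_det_gramD F e TV hVd TW hWd) (isUnit_det_gramDA F e TV hVd TW hWd) rfl γ

/-! #### S3c: on RATIONAL parabolic elements the prescribed scalar is `1` (`χ|_{L^×} = 1`, product formula) -/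

/-- the rational `det_Δ`: `det(γ₁₁ + γ₁₂)` over `L` for `γ ∈ H(L⁺)`.
[cite: GelbartRogawski1991, §3.1 Prop. 3.1.1 p. 455 L1–2] -/
def detDeltaRat (γ : UnitaryGroup.rational F E c (n + n) (hermD F E e TV TW)) : E :=
  ((Matrix.reindex (e₂ (n := n)).symm (e₂ (n := n)).symm ((γ : GL (Fin (n + n)) E) : Matrix (Fin (n + n)) (Fin (n + n)) E)).toBlocks₁₁ +
    (Matrix.reindex (e₂ (n := n)).symm (e₂ (n := n)).symm ((γ : GL (Fin (n + n)) E) : Matrix (Fin (n + n)) (Fin (n + n)) E)).toBlocks₁₂).det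

omit [NumberField F] [Algebra.IsQuadraticExtension F E] in
/-- `det_Δ (γ ⊗ 1) = det_Δ(γ) ⊗ 1`. [cite: GelbartRogawski1991, §3.1 Prop. 3.1.1 p. 455 L1–2] -/
theorem detDelta_toAdelic (γ : UnitaryGroup.rational F E c (n + n) (hermD F E e TV TW)) :
    detDelta F E c e TV TW (UnitaryGroup.toAdelic F E c (n + n) (hermD F E e TV TW) γ) =
      algebraMap E (AdeleRing (𝓞 E) E) (detDeltaRat F E c e TV TW γ) := by
  unfold detDelta deltaBlock detDeltaRat blk
  rw [RingHom.map_det, RingHom.mapMatrix_apply, Matrix.map_add _ (map_add _)]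
  rfl

omit [NumberField F] [Algebra.IsQuadraticExtension F E] in
/-- for RATIONAL `p ∈ H(L⁺)` with `det_Δ p` a unit, the idele `det_Δ p` is PRINCIPAL.
[cite: GelbartRogawski1991, §3.1 Prop. 3.1.1 p. 455 L1–2] -/
theorem detDelta_unit_mem_principalIdeles (p : HA F E c e TV TW) (hp : p ∈ ratH F E c e TV TW)
    (hu : IsUnit (detDelta F E c e TV TW p)) : hu.unit ∈ principalIdeles E := by
  obtain ⟨γ, hγ⟩ := MonoidHom.mem_range.1 hp
  have hd : detDelta F E c e TV TW p = algebraMap E (AdeleRing (𝓞 E) E) (detDeltaRat F E c e TV TW γ) := by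
    rw [← hγ]; exact detDelta_toAdelic F E c e TV TW γ
  have hne : detDeltaRat F E c e TV TW γ ≠ 0 := by
    intro h0
    rw [h0, map_zero] at hd
    haveI : Nontrivial (AdeleRing (𝓞 E) E) := (AdeleRing.algebraMap_injective (𝓞 E) E).nontrivial
    exact not_isUnit_zero (hd ▸ hu)
  refine ⟨Units.mk0 _ hne, Units.ext ?_⟩
  simp [hd]

omit [NumberField F] [Algebra.IsQuadraticExtension F E] in
/-- **S3c**: on rational `P_Δ`-elements the prescribed scalar `χ(det_Δ p) |det_Δ p|^{1/2}` is `1`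
(`HeckeCharacter.map_principal`, `ideleNorm_eq_one_of_mem_principalIdeles`).
[cite: GelbartRogawski1991, §3.1 Prop. 3.1.1 p. 455 L1–2] -/
theorem chiDet_mul_modDelta_eq_one_of_rational (χ : HeckeCharacter E) (p : HA F E c e TV TW)
    (hp : p ∈ ratH F E c e TV TW) (hu : IsUnit (detDelta F E c e TV TW p)) :
    ((chiDet F E c e TV TW χ p : ℂˣ) : ℂ) * (modDelta F E c e TV TW p : ℂ) = 1 := by
  have hprin := detDelta_unit_mem_principalIdeles F E c e TV TW p hp hu
  unfold chiDet modDelta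
  rw [dif_pos hu, dif_pos hu, HeckeCharacter.map_principal χ hprin, ideleNorm_eq_one_of_mem_principalIdeles hprin]
  simp

/-! #### S3b-val: `r_F^𝔻` of rational Levi ∕ unipotent generators has value-at-0 scalar `1` -/

/-- the submonoid of `Mp(𝕎^𝔻)ᶜᵒⁿᵗ` of elements whose operator preserves the value at the origin.
[cite: GelbartRogawski1991, §3.1 Prop. 3.1.1 p. 455 L1–2] -/
def evalZeroFixing : Submonoid (MpD F e TV TW) where
  carrier := {q | ∀ Φ : piSchwartzBruhat F (Fin (n + n)),
    opD F e TV TW q Φ 0 = (Φ : (Fin (n + n) → AdeleRing (𝓞 F) F) → ℂ) 0}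
  one_mem' := fun Φ => by
    change (((adelicMpCont.omega F (Fin (n + n)) (gramDA F e TV TW) 1 Φ :
      piSchwartzBruhat F (Fin (n + n))) : (Fin (n + n) → AdeleRing (𝓞 F) F) → ℂ) 0) = _
    rw [map_one, Module.End.one_apply]
  mul_mem' {q₁ q₂} h₁ h₂ Φ := by
    have e1 : (((adelicMpCont.omega F (Fin (n + n)) (gramDA F e TV TW) q₁
        (adelicMpCont.omega F (Fin (n + n)) (gramDA F e TV TW) q₂ Φ) :
          piSchwartzBruhat F (Fin (n + n))) : (Fin (n + n) → AdeleRing (𝓞 F) F) → ℂ) 0) =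
        (((adelicMpCont.omega F (Fin (n + n)) (gramDA F e TV TW) q₂ Φ :
          piSchwartzBruhat F (Fin (n + n))) : (Fin (n + n) → AdeleRing (𝓞 F) F) → ℂ) 0) := h₁ _
    have e2 : (((adelicMpCont.omega F (Fin (n + n)) (gramDA F e TV TW) q₂ Φ :
          piSchwartzBruhat F (Fin (n + n))) : (Fin (n + n) → AdeleRing (𝓞 F) F) → ℂ) 0) =
        (Φ : (Fin (n + n) → AdeleRing (𝓞 F) F) → ℂ) 0 := h₂ Φ
    change (((adelicMpCont.omega F (Fin (n + n)) (gramDA F e TV TW) (q₁ * q₂) Φ :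
      piSchwartzBruhat F (Fin (n + n))) : (Fin (n + n) → AdeleRing (𝓞 F) F) → ℂ) 0) = _
    rw [map_mul, Module.End.mul_apply, e1, e2]

include hVd hWd in
/-- `r_F^𝔻(m(γ))` (`Φ ↦ Φ ∘ γ⁻¹`, `coe_ratThetaLiftCont_levi` + `coe_toOp_leviPair`) preserves the value at `0`.
[cite: GelbartRogawski1991, §3.1 Prop. 3.1.1 p. 455 L1–2] -/
theorem rFD_levi_mem_evalZeroFixing (γ : GL (Fin (n + n)) F) :
    rFD F e TV hVd TW hWd (SymplecticMatrix.levi γ) ∈ evalZeroFixing F e TV TW := by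
  intro Φ
  have h1 := coe_ratThetaLiftCont_levi F (gramDA F e TV TW) (isUnit_det_gramDA F e TV hVd TW hWd) γ
  have h2 := coe_toOp_leviPair F (gramDA F e TV TW) (isUnit_det_gramDA F e TV hVd TW hWd)
    (ratGL F γ) Φ
  rw [← h1] at h2
  change ((MpPsi.toOp (adelicSchrodinger F (Fin (n + n)) (gramDA F e TV TW))
      (rFD F e TV hVd TW hWd (SymplecticMatrix.levi γ) : adelicMp F (Fin (n + n)) (gramDA F e TV TW)) Φ :
        piSchwartzBruhat F (Fin (n + n))) : (Fin (n + n) → AdeleRing (𝓞 F) F) → ℂ) 0 = _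
  rw [h2, twist_apply, Matrix.zero_vecMul]

include hVd hWd in
/-- `r_F^𝔻(v(σ))` (multiplication by `ψ(q_{−σ/2})`, `coe_ratThetaLiftCont_low` + `coe_toOp_unipPair`) preserves the value at `0`.
[cite: GelbartRogawski1991, §3.1 Prop. 3.1.1 p. 455 L1–2] -/
theorem rFD_low_mem_evalZeroFixing (σ : Matrix (Fin (n + n)) (Fin (n + n)) F) (hσ : σ.IsSymm) :
    rFD F e TV hVd TW hWd (SymplecticMatrix.low σ hσ) ∈ evalZeroFixing F e TV TW := by
  intro Φ
  have h1 := coe_ratThetaLiftCont_low F (gramDA F e TV TW) (isUnit_det_gramDA F e TV hVd TW hWd) σ hσ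
  have h2 := coe_toOp_unipPair F (gramDA F e TV TW) (isUnit_det_gramDA F e TV hVd TW hWd)
    (ratMatrix F σ) (hσ.map _) Φ
  rw [← h1] at h2
  change ((MpPsi.toOp (adelicSchrodinger F (Fin (n + n)) (gramDA F e TV TW))
      (rFD F e TV hVd TW hWd (SymplecticMatrix.low σ hσ) : adelicMp F (Fin (n + n)) (gramDA F e TV TW)) Φ :
        piSchwartzBruhat F (Fin (n + n))) : (Fin (n + n) → AdeleRing (𝓞 F) F) → ℂ) 0 = _
  rw [h2, chirp_apply, sdChar_apply, Matrix.zero_vecMul, dotProduct_zero, AddChar.map_zero_eq_one, Circle.coe_one, one_mul]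

include hVd hWd in
/-- **S3b-val**: `r_F^𝔻` of every element of the submonoid generated by rational Levi and unipotent generators (in particular of the
rational standard Siegel parabolic, once decomposed) has value-at-0 scalar `1`.
[cite: GelbartRogawski1991, §3.1 Prop. 3.1.1 p. 455 L1–2] -/
theorem rFD_mem_evalZeroFixing_of_mem_closure {P : Matrix.symplecticGroup (Fin (n + n)) F}
    (hP : P ∈ Submonoid.closure ((Set.range (SymplecticMatrix.levi (l := Fin (n + n)) (R := F))) ∪
      {x | ∃ σ hσ, x = SymplecticMatrix.low (l := Fin (n + n)) (R := F) σ hσ})) :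
    rFD F e TV hVd TW hWd P ∈ evalZeroFixing F e TV TW := by
  rw [← Submonoid.mem_comap]
  refine Submonoid.closure_le.2 ?_ hP
  rintro x (⟨γ, rfl⟩ | ⟨σ, hσ, rfl⟩)
  · exact rFD_levi_mem_evalZeroFixing F e TV hVd TW hWd γ
  · exact rFD_low_mem_evalZeroFixing F e TV hVd TW hWd σ hσ

end Literature.NumberTheory.GelbartRogawski1991.GRConstructionGen
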